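import Mathlib
import Summits.ResolutionOfSingularities.ResolutionOfSingularities.Theorems.HomologicalConductorPersistenceSurfaceFirstStepDoor
import Summits.ResolutionOfSingularities.ResolutionOfSingularities.Theorems.HomologicalConductorPersistenceCompletionAscentHolds
import Summits.ResolutionOfSingularities.ResolutionOfSingularities.Theorems.HomologicalConductorPersistenceCompletionIsolatedTransfer
import HarnessLib

/-!
# Rung S-2 `PersistenceSurface` (stmt-ResolutionOfSingularities-19970) — COMPLETION IS FREE:
# CSP‴ (registered stub C2) ⟺ the level-free transfer `LevelFourPersistenceRationalNormal'`, hence the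
# whole door of record is FOUR statements about the one step `loc A → T₁`

Route `ResolutionOfSingularities/HomologicalConductor`, chain W4.4b, rung S-2 `PersistenceSurface`
(stmt-ResolutionOfSingularities-19970), registered skeleton 1a77c002 (stubs C1
`stub_saturationFourSurfaceResidualFour`, C2 `stub_completedStepPersistenceRationalNormal'`, C3′
`stub_levelFourPersistenceNonnormalOrNonrational'`).  [OURS · bookkeeping over LANDED tree lemmas;
AI-written, weaker than expert review; NOT a statement of the manuscript under study (Hironaka 2017)
and no statement of that manuscript is used.]  DEF-FREE; every conjecture enters only as a hypothesis.

* `completedStep'_of_levelFourPersistenceRationalNormal'` — the converse of the landed glue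
  `levelFourPersistenceRationalNormal'_of_completedStep'` (p521182 lineage): CSP‴ ⟸ `RN′`.  The ascent
  half of [BahlekehHakimianSalarianTakahashi2015, Thm. 4.5 (2)], PROVED in the tree
  (`CompletionAscentHolds.le_caCompletion_comap_holds`: `caᴺ(T) ⊆ ca^{N+d}(T̂) ∩ T` when `T̂` is an
  isolated singularity), applies at every normalised stage `T_(m+1)` of a surface tower
  (`CompletionIsolatedTransfer.tower_isIsolatedSingularity_adicCompletion`, `dim T_(m+1) ≤ 2`).  So
  `completedStep'_iff_levelFourPersistenceRationalNormal'`: **the completion in CSP‴ carries no content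
  of its own** — stub C2 is exactly the level-four-source / level-free-target transfer on the class (R♮);
* `completedStep'_of_firstSteps_singular` — hence stub C2 ⟸ the three FIRST-STEP transfers
  `ca⁴(loc A) ⊆ ca(T₁)` on (R♮) / (Σ6) / (Σ8) at a singular `T₁` with `dim loc A = 2`
  (`…FirstStepDoor.levelFourPersistenceSurface'_of_firstSteps_singular`);
* `persistenceSurface_iff_levelFree_firstSteps_singular` — the LEVEL-FREE door of `…FirstStepDoor` is
  an EQUIVALENCE: rung S-2 ⟺ the conjunction of its three level-free first-step leaves (R)/(Σ6)/(Σ8)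
  at two-dimensional `loc A` with singular `T₁` (exact decomposition, nothing lost);
* `persistenceSurface_of_firstStepSat_of_firstSteps_singular` — DOOR OF RECORD WITHOUT CSP‴:
  `PersistenceSurface` (by name) ⟸ (NG₀) first-step `Sat₄` at a non-Gorenstein `loc A` of the residual
  class + the three first-step transfers; every premise is a statement about the single step
  `loc A → T₁` of an admissible surface datum with `T₁` singular.

References: A. Bahlekeh, E. Hakimian, S. Salarian, R. Takahashi, *Annihilation of cohomology, generation
of modules and finiteness of derived dimension*, Q. J. Math. 67 (2016), Thm. 4.5
[`BahlekehHakimianSalarianTakahashi2015`]; H. Matsumura, *Commutative Ring Theory*, §32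
[`Matsumura1987`] (excellence of essentially-finite-type algebras).
-/

noncomputable section

-- single-problem summit: the doubled namespace component `ResolutionOfSingularities` is forced
set_option linter.dupNamespace false

namespace Summit.ResolutionOfSingularities.ResolutionOfSingularities.Theorems.HomologicalConductor.PersistenceSurfaceCompletedStepIffLevelFree

open Literature.RingTheory.CohomologyAnnihilator
  (cohomologyAnnihilator cohomologyAnnihilatorOfDegree mem_cohomologyAnnihilatorOfDegree_iff
    mem_cohomologyAnnihilator_iff)
open Summit.ResolutionOfSingularities.ResolutionOfSingularities.Theses.HomologicalConductor
open Summit.ResolutionOfSingularities.ResolutionOfSingularities.Theorems.NoZeno.Birth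
open Summit.ResolutionOfSingularities.ResolutionOfSingularities.Theorems.HomologicalConductor.PersistenceSurfaceTowerDim
open Summit.ResolutionOfSingularities.ResolutionOfSingularities.Theorems.HomologicalConductor.PersistenceSurfaceSaturationResidual
  (IsMonicHypersurfaceLocalization exists_ringKrullDim_eq_nat)
open Summit.ResolutionOfSingularities.ResolutionOfSingularities.Theorems.HomologicalConductor.PersistenceSurfaceSaturationResidualThree
  (IsEdimHypersurfaceCandidate)
open Summit.ResolutionOfSingularities.ResolutionOfSingularities.Theorems.HomologicalConductor.PersistenceSurfaceSaturationResidualFour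
open Summit.ResolutionOfSingularities.ResolutionOfSingularities.Theorems.HomologicalConductor.PersistenceSurfaceCompletedStepLevelFree
open Summit.ResolutionOfSingularities.ResolutionOfSingularities.Theorems.HomologicalConductor.CompletionAscentHolds
  (le_caCompletion_comap_holds)
open Summit.ResolutionOfSingularities.ResolutionOfSingularities.Theorems.HomologicalConductor.CompletionIsolatedTransfer
  (tower_isIsolatedSingularity_adicCompletion)
open Summit.ResolutionOfSingularities.ResolutionOfSingularities.Theorems.HomologicalConductor.PersistenceSurfaceFirstStep
open Summit.ResolutionOfSingularities.ResolutionOfSingularities.Theorems.HomologicalConductor.PersistenceSurfaceFirstStepDoor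

variable {k K : Type} [Field k] [Field K] [Algebra k K]

/-! ## CSP‴ ⟸ the level-free transfer on (R♮): the completion is free -/

/-- **CSP‴ from `LevelFourPersistenceRationalNormal'` (the converse of
`levelFourPersistenceRationalNormal'_of_completedStep'`).**  Given `ca⁴(T_m) ⊆ ca(T_(m+1))` on the
class (R♮), an `x ∈ ca⁴(T_m)` lies in `caᴺ(T_(m+1))` for some `N`; `T_(m+1)` is noetherian local of
Krull dimension `d ≤ 2` and its completion is an isolated singularity
(`tower_isIsolatedSingularity_adicCompletion`), so the PROVED ascent [BHST 4.5 (2)]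
(`le_caCompletion_comap_holds`) puts the image of `x` in `ca^{N+d}(T̂_(m+1)) ⊆ ca(T̂_(m+1))`.
[cite: BahlekehHakimianSalarianTakahashi2015, Theorem 4.5 (2)] -/
theorem completedStep'_of_levelFourPersistenceRationalNormal' (hR : LevelFourPersistenceRationalNormal') :
    CompletedStepPersistenceRationalNormal' := by
  intro p hp k K _ _ _ _ O A hk hA hfr hAO hdim hRN m hle _ _ x hx
  haveI : IsFractionRing ↥A K := hfr
  -- `x ∈ ca⁴(T_m)` in the route's set-builder form, then `x ∈ ca(T_(m+1))` by `hR`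
  have hx4 := mem_cohomologyAnnihilatorOfDegree_iff.mp hx
  have hsub := hR p hp k K O A hk hA hfr hAO hdim hRN m
  have hxin : (x : K) ∈ {y : K | ∃ hy : y ∈ tower O A m, ∀ i : ℕ, 4 ≤ i →
      ∀ (M N : ModuleCat.{0} ↥(tower O A m)), Module.Finite ↥(tower O A m) M →
        Module.Finite ↥(tower O A m) N →
          ∀ e : CategoryTheory.Abelian.Ext.{0} M N i, (⟨y, hy⟩ : ↥(tower O A m)) • e = 0} :=
    ⟨x.2, hx4⟩
  have hmem : (x : K) ∈ ca (tower O A (m + 1)) := hsub hxin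
  obtain ⟨hxT, N, hN⟩ := hmem
  have hxN : (⟨(x : K), hxT⟩ : ↥(tower O A (m + 1))) ∈
      cohomologyAnnihilatorOfDegree ↥(tower O A (m + 1)) N :=
    mem_cohomologyAnnihilatorOfDegree_iff.mpr hN
  -- Krull dimension `d ≤ 2` of `T_(m+1)` and isolated singularity of its completion
  have hle2 : ringKrullDim ↥(tower O A (m + 1)) ≤ (2 : ℕ) :=
    ringKrullDim_tower_le_of_ringKrullDim_le O A hA hdim (m + 1)
  obtain ⟨d, hd, -⟩ := exists_ringKrullDim_eq_nat (d := 2) hle2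
  have htr : Algebra.trdeg k K ≤ 2 := trdeg_le_of_ringKrullDim_le A hA hdim
  have hiso := tower_isIsolatedSingularity_adicCompletion O A hk hA hfr hAO htr m
  -- ascent [BHST 4.5 (2)] at level `N`
  have hasc := le_caCompletion_comap_holds.{0} (↥(tower O A (m + 1))) d hd hiso N hxN
  rw [Ideal.mem_comap] at hasc
  have heq : Subalgebra.inclusion hle x = ⟨(x : K), hxT⟩ := Subtype.ext rfl
  rw [heq]
  exact mem_cohomologyAnnihilator_iff.mpr ⟨N + d, hasc⟩

/-- **Stub C2 is the level-free transfer on (R♮)**: `CompletedStepPersistenceRationalNormal' ↔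
LevelFourPersistenceRationalNormal'` (descent [BHST 4.5 (1)] one way, `…_of_completedStep'`, p521182
lineage; ascent [BHST 4.5 (2)] the other, above).  The completion in CSP‴ is a METHOD, not content.
[cite: BahlekehHakimianSalarianTakahashi2015, Theorem 4.5] -/
theorem completedStep'_iff_levelFourPersistenceRationalNormal' :
    CompletedStepPersistenceRationalNormal' ↔ LevelFourPersistenceRationalNormal' :=
  ⟨levelFourPersistenceRationalNormal'_of_completedStep', completedStep'_of_levelFourPersistenceRationalNormal'⟩

/-- `LevelFourPersistenceSurface' → LevelFourPersistenceRationalNormal'` (restriction to the class).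
[folklore] -/
theorem levelFourPersistenceRationalNormal'_of_surface' (hL : LevelFourPersistenceSurface') :
    LevelFourPersistenceRationalNormal' := by
  intro p hp k K _ _ _ _ O A hk hA hfr hAO hdim caAt' ca' loc' chart' nrm' tower' _ m
  exact hL p hp k K O A hk hA hfr hAO hdim m

/-! ## Stub C2 from first steps; the door of record without CSP‴ -/

/-- **Stub C2 (CSP‴) from FIRST STEPS INTO A SINGULAR STAGE.**  CSP‴ follows from the three first-step
transfers `ca⁴(loc A) ⊆ ca(T₁)` on (R♮) / (Σ6) / (Σ8), each demanded only for `T₁` singular and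
`dim loc A = 2` (`levelFourPersistenceSurface'_of_firstSteps_singular`, then restriction to (R♮) and
`completedStep'_of_levelFourPersistenceRationalNormal'`).  All three classes are needed: a later stage of
an (R♮) tower is stage `0` of a re-based datum whose class is decided afresh (Lipman (1.2) is not used).
[cite: BahlekehHakimianSalarianTakahashi2015, Theorem 4.5 (2)] -/
theorem completedStep'_of_firstSteps_singular
    (hRN : ∀ p : ℕ, p.Prime → ∀ (k K : Type) [Field k] [CharP k p] [Field K] [Algebra k K]
      (O : ValuationSubring K) (A : Subalgebra k K), (∀ c : k, algebraMap k K c ∈ O) → A.FG →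
      IsFractionRing ↥A K → A.toSubring ≤ O.toSubring → ringKrullDim ↥A ≤ 2 →
      ((IsIntegrallyClosed ↥(tower O A 0) ∧
          Literature.AlgebraicGeometry.Resolution.HasRationalSingularity ↥(tower O A 0)) ∨
        IsRegularLocalRing ↥(tower O A 0)) →
      ¬ IsRegularLocalRing ↥(tower O A 1) → ringKrullDim ↥(tower O A 0) = (2 : ℕ) →
      {x : K | ∃ hx : x ∈ tower O A 0, ∀ i : ℕ, 4 ≤ i → ∀ (M N : ModuleCat.{0} ↥(tower O A 0)),
          Module.Finite ↥(tower O A 0) M → Module.Finite ↥(tower O A 0) N →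
            ∀ e : CategoryTheory.Abelian.Ext.{0} M N i, (⟨x, hx⟩ : ↥(tower O A 0)) • e = 0} ⊆
        ca (tower O A 1))
    (hS6 : ∀ p : ℕ, p.Prime → ∀ (k K : Type) [Field k] [CharP k p] [Field K] [Algebra k K]
      (O : ValuationSubring K) (A : Subalgebra k K), (∀ c : k, algebraMap k K c ∈ O) → A.FG →
      IsFractionRing ↥A K → A.toSubring ≤ O.toSubring → ringKrullDim ↥A ≤ 2 →
      IsIntegrallyClosed ↥(tower O A 0) →
      ¬ Literature.AlgebraicGeometry.Resolution.HasRationalSingularity ↥(tower O A 0) →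
      ¬ IsRegularLocalRing ↥(tower O A 0) →
      ¬ IsRegularLocalRing ↥(tower O A 1) → ringKrullDim ↥(tower O A 0) = (2 : ℕ) →
      {x : K | ∃ hx : x ∈ tower O A 0, ∀ i : ℕ, 4 ≤ i → ∀ (M N : ModuleCat.{0} ↥(tower O A 0)),
          Module.Finite ↥(tower O A 0) M → Module.Finite ↥(tower O A 0) N →
            ∀ e : CategoryTheory.Abelian.Ext.{0} M N i, (⟨x, hx⟩ : ↥(tower O A 0)) • e = 0} ⊆
        ca (tower O A 1))
    (hS8 : ∀ p : ℕ, p.Prime → ∀ (k K : Type) [Field k] [CharP k p] [Field K] [Algebra k K]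
      (O : ValuationSubring K) (A : Subalgebra k K), (∀ c : k, algebraMap k K c ∈ O) → A.FG →
      IsFractionRing ↥A K → A.toSubring ≤ O.toSubring → ringKrullDim ↥A ≤ 2 →
      ¬ IsIntegrallyClosed ↥(tower O A 0) →
      ¬ IsRegularLocalRing ↥(tower O A 1) → ringKrullDim ↥(tower O A 0) = (2 : ℕ) →
      {x : K | ∃ hx : x ∈ tower O A 0, ∀ i : ℕ, 4 ≤ i → ∀ (M N : ModuleCat.{0} ↥(tower O A 0)),
          Module.Finite ↥(tower O A 0) M → Module.Finite ↥(tower O A 0) N →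
            ∀ e : CategoryTheory.Abelian.Ext.{0} M N i, (⟨x, hx⟩ : ↥(tower O A 0)) • e = 0} ⊆
        ca (tower O A 1)) :
    CompletedStepPersistenceRationalNormal' :=
  completedStep'_of_levelFourPersistenceRationalNormal'
    (levelFourPersistenceRationalNormal'_of_surface'
      (levelFourPersistenceSurface'_of_firstSteps_singular hRN hS6 hS8))

/-- **DOOR OF RECORD WITHOUT CSP‴ [OURS].**  `PersistenceSurface` (the route decl, by name) from four
statements about the single step `loc A → T₁` of an admissible surface datum with `T₁` SINGULAR and
`dim loc A = 2`: (NG₀) `Sat₄(loc A)` for `loc A` non-Gorenstein, not regular, not a monic-hypersurface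
localisation, not an edim-candidate; and the level-four-source transfers `ca⁴(loc A) ⊆ ca(T₁)` on
(R♮) normal-rational-or-regular, (Σ6) normal non-rational non-regular, (Σ8) non-normal `loc A`.
Composition of `saturationFourSurfaceResidual₄_of_firstStep_nonGorenstein`,
`levelFourPersistenceSurface'_of_firstSteps_singular` and the landed step-wise door
`persistenceSurface_of_residual₄_of_levelFour'`.  Nothing is asserted. [folklore] -/
theorem persistenceSurface_of_firstStepSat_of_firstSteps_singular
    (hNG : ∀ p : ℕ, p.Prime → ∀ (k K : Type) [Field k] [CharP k p] [Field K] [Algebra k K]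
      (O : ValuationSubring K) (A : Subalgebra k K), (∀ c : k, algebraMap k K c ∈ O) → A.FG →
      IsFractionRing ↥A K → A.toSubring ≤ O.toSubring → ringKrullDim ↥A ≤ 2 →
      ¬ (∀ (W : ModuleCat.{0} ↥(tower O A 0)), Module.Finite ↥(tower O A 0) W → ∀ i : ℕ, 3 ≤ i →
          ∀ e : CategoryTheory.Abelian.Ext.{0} W (ModuleCat.of ↥(tower O A 0) ↥(tower O A 0)) i,
            e = 0) →
      ¬ IsRegularLocalRing ↥(tower O A 0) → ¬ IsMonicHypersurfaceLocalization k 2 ↥(tower O A 0) →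
      ¬ IsEdimHypersurfaceCandidate 2 ↥(tower O A 0) → ¬ IsRegularLocalRing ↥(tower O A 1) →
      ringKrullDim ↥(tower O A 0) = (2 : ℕ) →
      ca (tower O A 0) ⊆
        {x : K | ∃ hx : x ∈ tower O A 0, ∀ i : ℕ, 4 ≤ i → ∀ (M N : ModuleCat.{0} ↥(tower O A 0)),
          Module.Finite ↥(tower O A 0) M → Module.Finite ↥(tower O A 0) N →
            ∀ e : CategoryTheory.Abelian.Ext.{0} M N i, (⟨x, hx⟩ : ↥(tower O A 0)) • e = 0})
    (hRN : ∀ p : ℕ, p.Prime → ∀ (k K : Type) [Field k] [CharP k p] [Field K] [Algebra k K]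
      (O : ValuationSubring K) (A : Subalgebra k K), (∀ c : k, algebraMap k K c ∈ O) → A.FG →
      IsFractionRing ↥A K → A.toSubring ≤ O.toSubring → ringKrullDim ↥A ≤ 2 →
      ((IsIntegrallyClosed ↥(tower O A 0) ∧
          Literature.AlgebraicGeometry.Resolution.HasRationalSingularity ↥(tower O A 0)) ∨
        IsRegularLocalRing ↥(tower O A 0)) →
      ¬ IsRegularLocalRing ↥(tower O A 1) → ringKrullDim ↥(tower O A 0) = (2 : ℕ) →
      {x : K | ∃ hx : x ∈ tower O A 0, ∀ i : ℕ, 4 ≤ i → ∀ (M N : ModuleCat.{0} ↥(tower O A 0)),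
          Module.Finite ↥(tower O A 0) M → Module.Finite ↥(tower O A 0) N →
            ∀ e : CategoryTheory.Abelian.Ext.{0} M N i, (⟨x, hx⟩ : ↥(tower O A 0)) • e = 0} ⊆
        ca (tower O A 1))
    (hS6 : ∀ p : ℕ, p.Prime → ∀ (k K : Type) [Field k] [CharP k p] [Field K] [Algebra k K]
      (O : ValuationSubring K) (A : Subalgebra k K), (∀ c : k, algebraMap k K c ∈ O) → A.FG →
      IsFractionRing ↥A K → A.toSubring ≤ O.toSubring → ringKrullDim ↥A ≤ 2 →
      IsIntegrallyClosed ↥(tower O A 0) →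
      ¬ Literature.AlgebraicGeometry.Resolution.HasRationalSingularity ↥(tower O A 0) →
      ¬ IsRegularLocalRing ↥(tower O A 0) →
      ¬ IsRegularLocalRing ↥(tower O A 1) → ringKrullDim ↥(tower O A 0) = (2 : ℕ) →
      {x : K | ∃ hx : x ∈ tower O A 0, ∀ i : ℕ, 4 ≤ i → ∀ (M N : ModuleCat.{0} ↥(tower O A 0)),
          Module.Finite ↥(tower O A 0) M → Module.Finite ↥(tower O A 0) N →
            ∀ e : CategoryTheory.Abelian.Ext.{0} M N i, (⟨x, hx⟩ : ↥(tower O A 0)) • e = 0} ⊆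
        ca (tower O A 1))
    (hS8 : ∀ p : ℕ, p.Prime → ∀ (k K : Type) [Field k] [CharP k p] [Field K] [Algebra k K]
      (O : ValuationSubring K) (A : Subalgebra k K), (∀ c : k, algebraMap k K c ∈ O) → A.FG →
      IsFractionRing ↥A K → A.toSubring ≤ O.toSubring → ringKrullDim ↥A ≤ 2 →
      ¬ IsIntegrallyClosed ↥(tower O A 0) →
      ¬ IsRegularLocalRing ↥(tower O A 1) → ringKrullDim ↥(tower O A 0) = (2 : ℕ) →
      {x : K | ∃ hx : x ∈ tower O A 0, ∀ i : ℕ, 4 ≤ i → ∀ (M N : ModuleCat.{0} ↥(tower O A 0)),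
          Module.Finite ↥(tower O A 0) M → Module.Finite ↥(tower O A 0) N →
            ∀ e : CategoryTheory.Abelian.Ext.{0} M N i, (⟨x, hx⟩ : ↥(tower O A 0)) • e = 0} ⊆
        ca (tower O A 1)) :
    Summit.ResolutionOfSingularities.ResolutionOfSingularities.Theses.HomologicalConductor.PersistenceSurface :=
  persistenceSurface_of_residual₄_of_levelFour'
    (saturationFourSurfaceResidual₄_of_firstStep_nonGorenstein hNG)
    (levelFourPersistenceSurface'_of_firstSteps_singular hRN hS6 hS8)

/-! ## The level-free door is an EQUIVALENCE -/

/-- **EXACT DECOMPOSITION [OURS]: `PersistenceSurface` ⟺ its three level-free first steps at a singular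
successor.**  The hypotheses of `persistenceSurface_of_levelFree_firstSteps_singular` — `ca(loc A) ⊆ ca(T₁)`
for two-dimensional `loc A` with `T₁` singular, on (R) normal rational singular / (Σ6) normal non-rational
non-regular / (Σ8) non-normal — are each an instance of the rung (`persistenceSurface_iff_firstStep`), so
the door loses nothing: the rung S-2 is EQUIVALENT to the conjunction of the three leaves. [folklore] -/
theorem persistenceSurface_iff_levelFree_firstSteps_singular :
    Summit.ResolutionOfSingularities.ResolutionOfSingularities.Theses.HomologicalConductor.PersistenceSurface ↔
    ((∀ p : ℕ, p.Prime → ∀ (k K : Type) [Field k] [CharP k p] [Field K] [Algebra k K]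
      (O : ValuationSubring K) (A : Subalgebra k K), (∀ c : k, algebraMap k K c ∈ O) → A.FG →
      IsFractionRing ↥A K → A.toSubring ≤ O.toSubring → ringKrullDim ↥A ≤ 2 →
      IsIntegrallyClosed ↥(tower O A 0) →
      Literature.AlgebraicGeometry.Resolution.HasRationalSingularity ↥(tower O A 0) →
      ¬ IsRegularLocalRing ↥(tower O A 0) →
      ¬ IsRegularLocalRing ↥(tower O A 1) → ringKrullDim ↥(tower O A 0) = (2 : ℕ) →
      ca (tower O A 0) ⊆ ca (tower O A 1)) ∧
    (∀ p : ℕ, p.Prime → ∀ (k K : Type) [Field k] [CharP k p] [Field K] [Algebra k K]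
      (O : ValuationSubring K) (A : Subalgebra k K), (∀ c : k, algebraMap k K c ∈ O) → A.FG →
      IsFractionRing ↥A K → A.toSubring ≤ O.toSubring → ringKrullDim ↥A ≤ 2 →
      IsIntegrallyClosed ↥(tower O A 0) →
      ¬ Literature.AlgebraicGeometry.Resolution.HasRationalSingularity ↥(tower O A 0) →
      ¬ IsRegularLocalRing ↥(tower O A 0) →
      ¬ IsRegularLocalRing ↥(tower O A 1) → ringKrullDim ↥(tower O A 0) = (2 : ℕ) →
      ca (tower O A 0) ⊆ ca (tower O A 1)) ∧
    (∀ p : ℕ, p.Prime → ∀ (k K : Type) [Field k] [CharP k p] [Field K] [Algebra k K]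
      (O : ValuationSubring K) (A : Subalgebra k K), (∀ c : k, algebraMap k K c ∈ O) → A.FG →
      IsFractionRing ↥A K → A.toSubring ≤ O.toSubring → ringKrullDim ↥A ≤ 2 →
      ¬ IsIntegrallyClosed ↥(tower O A 0) →
      ¬ IsRegularLocalRing ↥(tower O A 1) → ringKrullDim ↥(tower O A 0) = (2 : ℕ) →
      ca (tower O A 0) ⊆ ca (tower O A 1))) := by
  constructor
  · intro hP
    have hF := persistenceSurface_iff_firstStep.mp hP
    exact ⟨fun p hp k K _ _ _ _ O A hk hA hfr hAO hdim _ _ _ _ _ => hF p hp k K O A hk hA hfr hAO hdim,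
      fun p hp k K _ _ _ _ O A hk hA hfr hAO hdim _ _ _ _ _ => hF p hp k K O A hk hA hfr hAO hdim,
      fun p hp k K _ _ _ _ O A hk hA hfr hAO hdim _ _ _ => hF p hp k K O A hk hA hfr hAO hdim⟩
  · rintro ⟨hR, hS6, hS8⟩
    exact persistenceSurface_of_levelFree_firstSteps_singular hR hS6 hS8

end Summit.ResolutionOfSingularities.ResolutionOfSingularities.Theorems.HomologicalConductor.PersistenceSurfaceCompletedStepIffLevelFree

end
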